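import Mathlib

/-!
# Rank-one pencils are of column type or of row type

A family `D : ι → Matrix m n ℂ` all of whose linear combinations have rank `≤ 1` has either a
common left factor (`D i = u ⊗ vᵢ` for a fixed `u`) or a common right factor (`D i = uᵢ ⊗ v`
for a fixed `v`).

Proof sketch.
0. A matrix of rank `≤ 1` over a field is an outer product `vecMulVec c r` (its column space
   is spanned by one vector `c`; column `j` is `r j • c`).
1. Two-term lemma: if `vecMulVec a b + vecMulVec c d` has rank `≤ 1`, `c ≠ 0`, `b ≠ 0`, then
   `a ∈ span {c}` or `d ∈ span {b}`.  Indeed by (0) the sum is an outer product, so all its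
   `2 × 2` minors vanish; but the minor on rows `i₀, i₁` and columns `j₀, j₁` equals
   `(a i₀ c i₁ - a i₁ c i₀) (b j₀ d j₁ - b j₁ d j₀)`, and if neither conclusion holds one finds
   indices making both factors non-zero.
2. Globalisation: each `D i` is an outer product `uᵢ ⊗ vᵢ`; if all `D i = 0` we are done,
   otherwise fix `i₀` with `D i₀ = u₀ ⊗ v₀ ≠ 0`.  Applying (1) to `D i₀ + D i` shows every `i`
   is of column type (`D i = u₀ ⊗ v'`) or of row type (`D i = u' ⊗ v₀`).  If some `i₁` is of
   column type only and some `i₂` of row type only, (1) applied to `D i₂ + D i₁` gives a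
   contradiction.
-/

set_option linter.dupNamespace false

namespace Summit.MatrixMultiplication.MatrixMultiplication.Theorems

open Matrix

/-- `vecMulVec w 0 = 0` for rectangular shapes (Mathlib's `Matrix.vecMulVec_zero` is stated
for square shapes only). -/
private theorem hclR_vecMulVec_zero {α : Type*} [MulZeroClass α] {m n : Type*} (w : m → α) :
    vecMulVec w (0 : n → α) = 0 :=
  Matrix.ext fun _ _ => mul_zero _

/-- A matrix of rank `≤ 1` over a field is an outer product `vecMulVec c r`: its column space is
spanned by one vector `c`, and column `j` is `r j • c`. (Converse of Mathlib's
`Matrix.rank_vecMulVec_le`; folklore.) -/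
-- adapted from Literature.Computability.AlgebraicComplexity.exists_vecMulVec_of_rank_le_one
private theorem hclR_exists_vecMulVec_of_rank_le_one {K : Type*} [Field K] {m n : Type*}
    [Fintype n] [DecidableEq n] (M : Matrix m n K) (h : M.rank ≤ 1) :
    ∃ (c : m → K) (r : n → K), M = vecMulVec c r := by
  obtain ⟨v, hv⟩ := finrank_le_one_iff.mp h
  have hcol : ∀ j, ∃ a : K, ∀ i, a * (v : m → K) i = M i j := fun j => by
    have hj : M.col j ∈ LinearMap.range M.mulVecLin :=
      ⟨Pi.single j 1, by rw [Matrix.mulVecLin_apply, Matrix.mulVec_single_one]⟩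
    obtain ⟨a, ha⟩ := hv ⟨M.col j, hj⟩
    refine ⟨a, fun i => ?_⟩
    have := congrArg (fun w : LinearMap.range M.mulVecLin => (w : m → K) i) ha
    simpa using this
  choose a ha using hcol
  exact ⟨v, a, Matrix.ext fun i j => by rw [vecMulVec_apply, ← ha j i, mul_comm]⟩

/-- All `2 × 2` minors of an outer product vanish; for a sum of two outer products
`vecMulVec a b + vecMulVec c d` the minor on rows `i₀, i₁` and columns `j₀, j₁` factors as
`(a i₀ * c i₁ - a i₁ * c i₀) * (b j₀ * d j₁ - b j₁ * d j₀)` (Cauchy–Binet). -/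
private theorem hclR_minor_mul_minor_eq_zero {K : Type*} [Field K] {m n : Type*}
    {a c e : m → K} {b d f : n → K} (H : vecMulVec a b + vecMulVec c d = vecMulVec e f)
    (i₀ i₁ : m) (j₀ j₁ : n) :
    (a i₀ * c i₁ - a i₁ * c i₀) * (b j₀ * d j₁ - b j₁ * d j₀) = 0 := by
  have h : ∀ i j, a i * b j + c i * d j = e i * f j := fun i j => by
    have := congrArg (fun M : Matrix m n K => M i j) H
    simpa [Matrix.add_apply, vecMulVec_apply] using this
  calc (a i₀ * c i₁ - a i₁ * c i₀) * (b j₀ * d j₁ - b j₁ * d j₀)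
      = (a i₀ * b j₀ + c i₀ * d j₀) * (a i₁ * b j₁ + c i₁ * d j₁) -
          (a i₀ * b j₁ + c i₀ * d j₁) * (a i₁ * b j₀ + c i₁ * d j₀) := by ring
    _ = (e i₀ * f j₀) * (e i₁ * f j₁) - (e i₀ * f j₁) * (e i₁ * f j₀) := by
          rw [h i₀ j₀, h i₁ j₁, h i₀ j₁, h i₁ j₀]
    _ = 0 := by ring

/-- If `w ≠ 0` (say `w k₀ ≠ 0`) and `z` is not a multiple of `w`, then some `2 × 2` minor
`z k₁ * w k₀ - z k₀ * w k₁` of the pair `(w, z)` is non-zero. -/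
private theorem hclR_exists_minor_ne_zero {K : Type*} [Field K] {σ : Type*} {w z : σ → K}
    {k₀ : σ} (hk₀ : w k₀ ≠ 0) (hz : ∀ s : K, z ≠ s • w) :
    ∃ k₁, z k₁ * w k₀ - z k₀ * w k₁ ≠ 0 := by
  by_contra hcon
  push Not at hcon
  refine hz (z k₀ / w k₀) (funext fun k => ?_)
  have hk := hcon k
  rw [sub_eq_zero] at hk
  rw [Pi.smul_apply, smul_eq_mul, div_mul_eq_mul_div, eq_div_iff hk₀, hk]

/-- Two-term lemma: if `vecMulVec a b + vecMulVec c d` has rank `≤ 1`, `c ≠ 0` and `b ≠ 0`,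
then `a` is a multiple of `c` or `d` is a multiple of `b`. -/
private theorem hclR_two_term {K : Type*} [Field K] {m n : Type*} [Fintype m] [Fintype n]
    [DecidableEq n] {a c : m → K} {b d : n → K}
    (h : (vecMulVec a b + vecMulVec c d).rank ≤ 1) (hc : c ≠ 0) (hb : b ≠ 0) :
    (∃ s : K, a = s • c) ∨ (∃ t : K, d = t • b) := by
  obtain ⟨e, f, hef⟩ := hclR_exists_vecMulVec_of_rank_le_one _ h
  by_contra hcon
  push Not at hcon
  obtain ⟨ha, hd⟩ := hcon
  obtain ⟨i₀, hi₀⟩ := Function.ne_iff.mp hc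
  obtain ⟨j₀, hj₀⟩ := Function.ne_iff.mp hb
  obtain ⟨i₁, hi₁⟩ := hclR_exists_minor_ne_zero hi₀ ha
  obtain ⟨j₁, hj₁⟩ := hclR_exists_minor_ne_zero hj₀ hd
  have := hclR_minor_mul_minor_eq_zero hef i₀ i₁ j₀ j₁
  rcases mul_eq_zero.mp this with h0 | h0
  · apply hi₁
    simp only [Pi.zero_apply] at hi₀ ⊢
    linear_combination -h0
  · apply hj₁
    simp only [Pi.zero_apply] at hj₀ ⊢
    linear_combination h0

/-- A family of complex matrices all of whose linear combinations have rank ≤ 1 is either of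
column type (a common left factor `u`) or of row type (a common right factor `v`). Classical. -/
theorem hclR_rank_le_one_pencil_dichotomy {ι m n : Type*} [Fintype ι] [Fintype m] [Fintype n]
    [DecidableEq m] [DecidableEq n]
    (D : ι → Matrix m n ℂ) (h : ∀ c : ι → ℂ, (∑ i, c i • D i).rank ≤ 1) :
    (∃ u : m → ℂ, ∀ i, ∃ v : n → ℂ, D i = Matrix.vecMulVec u v) ∨
    (∃ v : n → ℂ, ∀ i, ∃ u : m → ℂ, D i = Matrix.vecMulVec u v) := by
  classical
  -- each `D i` has rank `≤ 1`
  have h1 : ∀ i, (D i).rank ≤ 1 := fun i => by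
    have := h (Pi.single i 1)
    simpa [Pi.single_apply, ite_smul, Finset.sum_ite_eq'] using this
  -- each `D i + D j`, `i ≠ j`, has rank `≤ 1`
  have h2 : ∀ i j, i ≠ j → (D i + D j).rank ≤ 1 := fun i j hij => by
    have := h (Pi.single i 1 + Pi.single j 1)
    simpa [Pi.add_apply, add_smul, Finset.sum_add_distrib, Pi.single_apply, ite_smul,
      Finset.sum_ite_eq', hij] using this
  choose u v huv using fun i => hclR_exists_vecMulVec_of_rank_le_one (D i) (h1 i)
  by_cases hzero : ∀ i, D i = 0
  · exact Or.inl ⟨0, fun i => ⟨0, by rw [hzero i, zero_vecMulVec]⟩⟩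
  push Not at hzero
  obtain ⟨i₀, hi₀⟩ := hzero
  have hu₀ : u i₀ ≠ 0 := fun h0 => hi₀ (by rw [huv i₀, h0, zero_vecMulVec])
  have hv₀ : v i₀ ≠ 0 := fun h0 => hi₀ (by rw [huv i₀, h0, hclR_vecMulVec_zero])
  -- every index is of column type or of row type
  have key : ∀ i, (∃ v' : n → ℂ, D i = vecMulVec (u i₀) v') ∨
      (∃ u' : m → ℂ, D i = vecMulVec u' (v i₀)) := by
    intro i
    by_cases hi : i₀ = i
    · subst hi
      exact Or.inl ⟨v i₀, huv i₀⟩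
    by_cases hui : u i = 0
    · refine Or.inl ⟨0, ?_⟩
      rw [huv i, hui, zero_vecMulVec, hclR_vecMulVec_zero]
    have hr : (vecMulVec (u i₀) (v i₀) + vecMulVec (u i) (v i)).rank ≤ 1 := by
      rw [← huv, ← huv]
      exact h2 i₀ i hi
    rcases hclR_two_term hr hui hv₀ with ⟨s, hs⟩ | ⟨t, ht⟩
    · have hs0 : s ≠ 0 := by
        rintro rfl
        exact hu₀ (by rw [hs, zero_smul])
      refine Or.inl ⟨s⁻¹ • v i, ?_⟩
      rw [huv i, vecMulVec_smul, ← smul_vecMulVec, hs, smul_smul, inv_mul_cancel₀ hs0, one_smul]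
    · exact Or.inr ⟨t • u i, by rw [huv i, ht, vecMulVec_smul, smul_vecMulVec]⟩
  by_cases hcol : ∀ i, ∃ v' : n → ℂ, D i = vecMulVec (u i₀) v'
  · exact Or.inl ⟨u i₀, hcol⟩
  by_cases hrow : ∀ i, ∃ u' : m → ℂ, D i = vecMulVec u' (v i₀)
  · exact Or.inr ⟨v i₀, hrow⟩
  exfalso
  push Not at hcol hrow
  obtain ⟨i₁, hi₁⟩ := hrow
  obtain ⟨i₂, hi₂⟩ := hcol
  obtain ⟨v₁, hv₁⟩ := (key i₁).resolve_right (not_exists.mpr hi₁)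
  obtain ⟨u₂, hu₂⟩ := (key i₂).resolve_left (not_exists.mpr hi₂)
  have hne : i₂ ≠ i₁ := by
    rintro rfl
    exact hi₂ v₁ hv₁
  have hr : (vecMulVec u₂ (v i₀) + vecMulVec (u i₀) v₁).rank ≤ 1 := by
    rw [← hu₂, ← hv₁]
    exact h2 i₂ i₁ hne
  rcases hclR_two_term hr hu₀ hv₀ with ⟨s, hs⟩ | ⟨t, ht⟩
  · exact hi₂ (s • v i₀) (by rw [hu₂, hs, smul_vecMulVec, vecMulVec_smul])
  · exact hi₁ (t • u i₀) (by rw [hv₁, ht, vecMulVec_smul, smul_vecMulVec])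

end Summit.MatrixMultiplication.MatrixMultiplication.Theorems
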